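/-
COR-CM (cells pub-hodgecm / pub-hodgecm2, stage 2 of the Hodge ladder) — junction B01, item (vi) S2 pinning lane: CARRIERS-PLAN step S2
(R1, μ-part) of `hodge-director/CARRIERS-PLAN.md` v1.0 (COORDINATOR RULING 2026-08-22T01:02:39Z «HODGE S-LANE: CARRIERS PLAN»; owners of S2
= pin-3 successor + own-htheta).  THE CHOSEN CHARACTER `μ(Φ, ι₁)` AS A NAMED TREE OBJECT: for a CM field `F`, a CM type `Φ` and an
embedding `ι₁`, a REAL weight-one conjugate symplectic character `μ` of `C_F` whose CM type `Φ_μ` is the INVERSE TYPE `Φ^{*ι₁} =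
Transposition.invType ι₁ Φ` (item (ii)), obtained by `Classical.choose` from the tree theorem
`IdeleClassGroup.exists_isConjugateSymplectic_hasCMType` ([WeilBNT1967] VII §3; [Liu2021] Def. 4.3) — exactly the construction inside the
certificate `Item6SupplyPinnedCertificate.lean` (p300513, `exists_pinnedDatum_of_faceSupply`), lifted to a declaration.  CONSEQUENCE: at ANY
`Thm418Data` / `Thm418Rest` whose field `μ` IS this character, the END displays' CHOICE binder
`hμ : ι₁ ∘ g ∈ Φ_μ ↔ ι₁ ∘ g⁻¹ ∈ Φ` (`Item6SupplyPinned.lean` p297535; `Item6SupplyPinnedAssemblyAlongHolds.lean` p311451 §1/§3) is a THEOREM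
(`Transposition.thm418Data_comp_mem_cmType_iff_of_mu_eq`), not a hypothesis.  Seat prover-pub-hodgecm-own-htheta-g4-0 (own-htheta gen 4, S2-CRUX owner;
rule-(1) blanket `Transposition/Item6*`).  One `def` (a `Classical.choose`, no new mathematics) + theorems; no instance, no named fact, no
`sorry`; no other lane's file is modified.  HC_CM is NOT proved; S2 is NOT closed; this discharges no displayed binder of the tree by itself
(the END display's `R` is still POSITED) — it is the μ-component for the plan's S7 re-cut `R := restOne … (μ := muOfInvType ι₁ Φ) …`.
-/
import Summits.HodgeConjecture.CorCM.B01.Transposition.Item2Holds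
import Literature.NumberTheory.Automorphic.Liu2021.Thm418AsPrinted
import HarnessLib

/-!
# The chosen character `μ(Φ, ι₁)` of CM type `Φ^{*ι₁}` (CARRIERS-PLAN S2, μ-part)

* `Transposition.muOfInvType ι₁ Φ : IdeleClassGroup F →ₜ* Circle` (for `F/ℚ` Galois, as `invType` requires; the END displays'
  guard `IsGalois ℚ F →`) — `Classical.choose` of
  `IdeleClassGroup.exists_isConjugateSymplectic_hasCMType (invType ι₁ Φ)`;
* `isConjugateSymplectic_muOfInvType`, `hasWeight_one_muOfInvType`, `hasCMType_muOfInvType` — its three printed attributes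
  ([Liu2021] Def. 4.1 «conjugate symplectic», Def. 4.3 (1) «weight one», Def. 4.3 (2) «CM type `Φ_μ`» `= Φ^{*ι₁}`);
* `cmType_muOfInvType : Φ_μ = invType ι₁ Φ` and `comp_mem_cmType_muOfInvType_iff : ι₁ ∘ g ∈ Φ_μ ↔ ι₁ ∘ g⁻¹ ∈ Φ` (for ANY proof of
  conjugate-symplecticity — proof-irrelevant);
* `Transposition.thm418Data_comp_mem_cmType_iff_of_mu_eq` — for any Liu datum `D : Thm418Data F⁺ F` (the App-C presentation
  `Thm418Data (maximalRealSubfield F) F` included) with `D.μ = muOfInvType ι₁ Φ`: `ι₁ ∘ g ∈ D.cmType ↔ ι₁ ∘ g⁻¹ ∈ Φ` — the END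
  displays' `hμ` text, as a theorem.
HC_CM is NOT proved.
-/

noncomputable section

set_option autoImplicit false

namespace Summit.HodgeConjecture.CorCM

namespace Transposition

open Literature.AlgebraicGeometry.Motives (CMType)
open Literature.NumberTheory.Automorphic
open NumberField

variable {F : CMField} [IsGalois ℚ F] (ι₁ : F →+* ℂ) (Φ : CMType F)

/-- **The chosen character `μ(Φ, ι₁)`**: a continuous unitary character of the idele class group `C_F` which is conjugate
symplectic, of weight one, and of CM type the inverse type `Φ^{*ι₁} = invType ι₁ Φ` — `Classical.choose` of the tree's existence
theorem `IdeleClassGroup.exists_isConjugateSymplectic_hasCMType` ([WeilBNT1967] Ch. VII §3).  The consumer's CHOICE of [Liu2021]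
§4's `μ` for the face datum `(F, Φ, ι₁)`. [cite: Liu2021, Def. 4.3; WeilBNT1967, Ch. VII §3] -/
def muOfInvType : IdeleClassGroup F →ₜ* Circle :=
  (IdeleClassGroup.exists_isConjugateSymplectic_hasCMType (L := F) (invType ι₁ Φ)).choose

/-- `μ(Φ, ι₁)` is conjugate symplectic ([Liu2021] Def. 4.1: `μ|_{𝔸_F⁺^×} = μ_{F/F⁺}`). [cite: Liu2021, Def. 4.1] -/
theorem isConjugateSymplectic_muOfInvType : IdeleClassGroup.IsConjugateSymplectic F (muOfInvType ι₁ Φ) :=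
  (IdeleClassGroup.exists_isConjugateSymplectic_hasCMType (L := F) (invType ι₁ Φ)).choose_spec.1

/-- `μ(Φ, ι₁)` has weight one ([Liu2021] Def. 4.3 (1)). [cite: Liu2021, Def. 4.3 (1)] -/
theorem hasWeight_one_muOfInvType : IdeleClassGroup.HasWeight F (muOfInvType ι₁ Φ) 1 :=
  (IdeleClassGroup.exists_isConjugateSymplectic_hasCMType (L := F) (invType ι₁ Φ)).choose_spec.2.1

/-- `μ(Φ, ι₁)` has CM type `Φ^{*ι₁}` ([Liu2021] Def. 4.3 (2), relational form `HasCMType`). [cite: Liu2021, Def. 4.3 (2)] -/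
theorem hasCMType_muOfInvType : IdeleClassGroup.HasCMType F (muOfInvType ι₁ Φ) (invType ι₁ Φ) :=
  (IdeleClassGroup.exists_isConjugateSymplectic_hasCMType (L := F) (invType ι₁ Φ)).choose_spec.2.2

/-- **`Φ_μ = Φ^{*ι₁}`** for `μ = μ(Φ, ι₁)`, for ANY proof `h` of conjugate-symplecticity (the CM type `h.cmType` depends on `μ`
only). [folklore] -/
theorem cmType_muOfInvType (h : IdeleClassGroup.IsConjugateSymplectic F (muOfInvType ι₁ Φ)) :
    h.cmType = invType ι₁ Φ :=
  h.cmType_eq (hasCMType_muOfInvType ι₁ Φ)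

/-- **The CHOICE binder `hμ` of the S2 END displays, as a theorem for `μ = μ(Φ, ι₁)`:** `ι₁ ∘ g ∈ Φ_μ ↔ ι₁ ∘ g⁻¹ ∈ Φ` for every
`g ∈ Aut(F/ℚ)` (item (ii)'s `isInverse` relation, `comp_mem_invType_iff`). [folklore] -/
theorem comp_mem_cmType_muOfInvType_iff (h : IdeleClassGroup.IsConjugateSymplectic F (muOfInvType ι₁ Φ)) (g : F ≃ₐ[ℚ] F) :
    ι₁.comp (g : F →+* F) ∈ h.cmType.1 ↔ ι₁.comp (g.symm : F →+* F) ∈ Φ.1 := by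
  rw [cmType_muOfInvType ι₁ Φ h]
  exact comp_mem_invType_iff ι₁ Φ g

/-- The same for an arbitrary character KNOWN to equal `μ(Φ, ι₁)` (the form in which a structure field `μ` is met). [folklore] -/
theorem comp_mem_cmType_iff_of_eq_muOfInvType {ψ : IdeleClassGroup F →ₜ* Circle} (hψ : ψ = muOfInvType ι₁ Φ)
    (h : IdeleClassGroup.IsConjugateSymplectic F ψ) (g : F ≃ₐ[ℚ] F) :
    ι₁.comp (g : F →+* F) ∈ h.cmType.1 ↔ ι₁.comp (g.symm : F →+* F) ∈ Φ.1 := by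
  subst hψ
  exact comp_mem_cmType_muOfInvType_iff ι₁ Φ h g

end Transposition

end Summit.HodgeConjecture.CorCM

namespace Summit.HodgeConjecture.CorCM.Transposition

open Literature.AlgebraicGeometry.Motives (CMType)
open Literature.NumberTheory.Automorphic.Liu2021

/-- **The END displays' `hμ` AT A LIU DATUM WHOSE `μ` IS THE CHOSEN CHARACTER** (App-C presentation `Thm418Data (maximalRealSubfield F) F`
included, any `F₀` with `F/F₀` totally imaginary quadratic): if `D.μ = μ(Φ, ι₁)` then `ι₁ ∘ g ∈ Φ_μ(D) ↔ ι₁ ∘ g⁻¹ ∈ Φ` for every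
`g ∈ Aut(F/ℚ)` — `Thm418Data.cmType` is `D.isConjugateSymplectic.cmType` under the (proof-irrelevant) `IsCMField` instance of §4 l. 1878.
This is the binder `hμ` of `Model.faceSupply_of_thm418AsPrinted_along_conj_holds` (p311451 :131–134) / `…_pinned` (p297535) at such a `D`,
discharged. [cite: Liu2021, Def. 4.3 (2), Thm. 4.18] -/
theorem thm418Data_comp_mem_cmType_iff_of_mu_eq {F : CMField} [IsGalois ℚ F] {F₀ : Type} [Field F₀] [NumberField F₀]
    [NumberField.IsTotallyReal F₀] [Algebra F₀ F] [NumberField.IsTotallyComplex F] [Algebra.IsQuadraticExtension F₀ F] (D : Thm418Data F₀ F) (ι₁ : F →+* ℂ) (Φ : CMType F)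
    (hD : D.μ = muOfInvType ι₁ Φ) (g : F ≃ₐ[ℚ] F) :
    ι₁.comp (g : F →+* F) ∈ D.cmType.1 ↔ ι₁.comp (g.symm : F →+* F) ∈ Φ.1 :=
  comp_mem_cmType_iff_of_eq_muOfInvType ι₁ Φ hD _ g

end Summit.HodgeConjecture.CorCM.Transposition

end

#print axioms Summit.HodgeConjecture.CorCM.Transposition.comp_mem_cmType_muOfInvType_iff
#print axioms Summit.HodgeConjecture.CorCM.Transposition.thm418Data_comp_mem_cmType_iff_of_mu_eq
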